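import Literature.NumberTheory.ComplexMultiplication.CMOrderLocalMinimalGenerators
import Literature.NumberTheory.ComplexMultiplication.CMOrderMultiplicatorRingExtension
import Mathlib.FieldTheory.Finiteness
import Mathlib.LinearAlgebra.FreeModule.Finite.CardQuotient
import Mathlib.LinearAlgebra.Basis.Submodule
import HarnessLib

/-!
# The index of a sublattice of a number field is a determinant, `[I : J] = |det_ν(ν')|`, the trace dual
# reverses indices, `[I : J] = [Jᵗ : Iᵗ]` (MARSEGLIA 2024 LEMMA 2.4 (iv), the cardinality statement), and
# PROPOSITION 3.5: `#((𝔭:𝔭)/𝔭) = #(𝔯/𝔭)^(type_𝔭(𝔯) + 1)` at a non-invertible prime `𝔭` of an order `𝔯`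

Family `hodge`, lane `lit-hodgefound` (Track 2 foundations library; seat p15, row g27-#4), topic
`Literature/NumberTheory/ComplexMultiplication`, namespace `Literature.NumberTheory.ComplexMultiplication.CMTypeLattice`
(the lattice vocabulary of `CMLatticeTraceDual` / `CMOrderGorenstein`: a full `ℤ`-lattice of the number field `K` is
`Submodule.span ℤ (Set.range ν)` for a `ℚ`-basis `ν : Basis ι ℚ K`; its trace dual is Mathlib's
`Submodule.traceDual ℤ ℚ`, spanned by the dual basis `ν.traceDual` (`traceDual_span_eq`); the index `[I : J]` of
`J ⊆ I` is `Nat.card (↥I ⧸ J.comap I.subtype)` = Mathlib's `AddSubgroup.relIndex`; the order is `𝔯 = endOrder (M_μ)`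
with trace dual `𝔯ᵗ = T`, `↑T = traceDual ℤ ℚ ↑1`, and `I/𝔭I = ↥I ⧸ 𝔭 • ⊤` over `𝔯 ⧸ 𝔭` as in
`CMOrderCohenMacaulayTypeOne`).  THEOREMS ONLY: no definition, no instance, no named fact (net Literature debt `0`).

## Source, VERBATIM

S. Marseglia, *Cohen-Macaulay type of orders, generators and ideal classes*, J. Algebra 658 (2024) 247–276
[Marseglia2024CMType] (arXiv:2206.03758, chunks p0005–p0006, §2.3): "Lemma 2.4. Let `I` and `J` be fractional
`S`-ideals. (i) `IJ`, `I+J`, `I ∩ J`, `(I:J)` and `I^t` are fractional `S`-ideals. (ii) `I` contains a non-zero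
element of `Z`. (iii) `I J^t = (J:I)^t`. (iv) If `J ⊆ I` then the `Z`-modules `I/J` and `J^t/I^t` are isomorphic.
Proof. […] Put `M = I/J`. Observe that `M` is a torsion module over the Dedekind domain `Z`. Hence `M` has finite
length as a `Z`-module. […] every module of finite length over a Dedekind domain is isomorphic to its Matlis dual.
[…] Hence we have an isomorphism of `Z`-modules `M ≃ Hom_Z(M, E)`. To conclude the proof, it is enough to observe
that we have an `S`-linear isomorphism `J^t/I^t ≃ Hom_Z(M, E)`"; used in §3, chunk p0009, proof of Proposition 3.5:
"the quotient `(𝔭S^t)^t/S = (𝔭:𝔭)/S` is isomorphic (as a `Z`-module) to `S^t/𝔭S^t` by Lemma 2.4.(iv) […] Hence,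
comparing the dimensions over `Z/p` […]"; and (chunk p0009) "Proposition 3.5. Let `𝔭` be a non-invertible
prime of `S`. Then `type_𝔭(S) + 1 = dim_{S/𝔭} (𝔭:𝔭)/𝔭`. Proof. Using Lemmas 2.4.(iii) and 2.8, we see that
`(𝔭S^t)^t = (S:𝔭) = (𝔭:𝔭)`. Therefore, the quotient `(𝔭S^t)^t/S = (𝔭:𝔭)/S` is isomorphic (as a `Z`-module) to
`S^t/𝔭S^t` by Lemma 2.4.(iv). Recall that `S/𝔭` is a finite field extension of `Z/p` […]. Hence, comparing the
dimensions over `Z/p`, we conclude that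
`dim_{S/𝔭} (𝔭:𝔭)/𝔭 = dim_{S/𝔭} ((𝔭:𝔭)/S ⊕ S/𝔭) = dim_{S/𝔭} S^t/𝔭S^t + 1`. □"

## What is formalised — the CARDINALITY statement `#(I/J) = #(Jᵗ/Iᵗ)`, by determinants

(The `ℤ`-module ISOMORPHISM `I/J ≃ Jᵗ/Iᵗ` of Lemma 2.4 (iv) needs Matlis/Pontryagin duality of finite abelian
groups and is NOT formalised; Proposition 3.5 only compares cardinalities — `TODO(general form)`.)

* §1 **`natCard_quotient_comap_span_eq_abs_det`: `[⊕ ℤνᵢ : ⊕ ℤν'ⱼ] = |det_ν(ν')|`** for `⊕ ℤν'ⱼ ⊆ ⊕ ℤνᵢ`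
  (Mathlib's `Submodule.natAbs_det_basis_change` on the `ℤ`-bases `ν.restrictScalars ℤ`, `ν'.restrictScalars ℤ`,
  read in `ℚ`); plumbing `natCard_quotient_comap_congr`, `toMatrix_restrictScalars_map`.
* §2 **`traceDual_toMatrix_traceDual`: the matrix of `νᵗ` on `ν'ᵗ` is the TRANSPOSE of the matrix of `ν'` on
  `ν`** (`Tr(νᵗᵢ ν'ₖ) = (ν'ₖ)ᵢ`), `traceDual_det_traceDual` (`det_{ν'ᵗ}(νᵗ) = det_ν(ν')`).
* §3 **`natCard_quotient_comap_eq_natCard_quotient_traceDual`: `[I : J] = [Jᵗ : Iᵗ]`** for full lattices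
  `J ⊆ I` of `K` (LEMMA 2.4 (iv), cardinalities), and `abs_det_eq_natCard_quotient_traceDual`.
* §4 the order series `𝔯 = endOrder (M_μ)`: **`natCard_quotient_coe_eq_natCard_quotient_traceDual`** — for
  nonzero fractional `𝔯`-ideals `J ⊆ I` with trace duals `T_I`, `T_J` (`↑T = ↑Iᵗ` as in `CMOrderGorenstein`),
  `#(I/J) = #(T_J/T_I)`.
* §5 **PROPOSITION 3.5, `natCard_quotient_div_self_comap_coeIdeal_eq_pow`: `#((𝔭:𝔭)/𝔭) = #(𝔯/𝔭)^(type_𝔭(𝔯)+1)`**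
  at a non-invertible maximal `𝔭` of `𝔯 = endOrder (M_μ)`, where `type_𝔭(𝔯) = dim_{𝔯/𝔭} 𝔯ᵗ/𝔭𝔯ᵗ` is the local
  Cohen–Macaulay type of `CMOrderCohenMacaulayTypeOne` (the printed `dim_{S/𝔭} (𝔭:𝔭)/𝔭 = type_𝔭(S) + 1` read on
  cardinalities, `(𝔭:𝔭) = ↑𝔭/↑𝔭`); the printed steps `natCard_quotient_div_self_comap_one_eq`
  (`#((𝔭:𝔭)/𝔯) = #(𝔯ᵗ/𝔭𝔯ᵗ)`: §4 with `(𝔭𝔯ᵗ)ᵗ = (𝔯:𝔭) = (𝔭:𝔭)`, `CMOrderGorenstein.coe_div_eq_traceDual_mul`,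
  `CMOrderMultiplicatorRingExtension.coeIdeal_div_self_eq_one_div_of_not_isUnit`), the tower
  `#((𝔭:𝔭)/𝔭) = #((𝔭:𝔭)/𝔯)·#(𝔯/𝔭)` (Mathlib `AddSubgroup.relIndex_mul_relIndex` via `natCard_quotient_comap_eq_relIndex`),
  `natCard_quotient_coe_one_comap_coeIdeal` (`#(↑1/↑𝔭) = #(𝔯 ⧸ 𝔭)`), `natCard_quotient_comap_coeIdeal_mul`
  (`#(I/𝔭I) = #(↥I ⧸ 𝔭 • ⊤) = #(𝔯/𝔭)^{dim}`, Mathlib `Module.natCard_eq_pow_finrank`).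
-/

noncomputable section

open scoped nonZeroDivisors NumberField
open NumberField Module FractionalIdeal
open Submodule (traceDual span)

namespace Literature.NumberTheory.ComplexMultiplication

namespace CMTypeLattice

variable {K : Type} [Field K] [NumberField K]
variable {ι : Type} [Fintype ι] [DecidableEq ι]

/-! ## §1 The index of a sublattice is the absolute value of the determinant of a basis change -/

omit [NumberField K] in
/-- Plumbing: the index `#(I/J)` only depends on the pair of submodules («the `Z`-modules `I/J`»).
[cite: Marseglia2024CMType, §2.3 Lemma 2.4 (iv), p. 6] -/
theorem natCard_quotient_comap_congr {R : Type*} [Ring R] [Module R K] {I I' J J' : Submodule R K}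
    (hI : I = I') (hJ : J = J') :
    Nat.card (I ⧸ J.comap I.subtype) = Nat.card (I' ⧸ J'.comap I'.subtype) := by
  subst hI hJ
  rfl

omit [Fintype ι] [DecidableEq ι] in
/-- Plumbing: the `ℤ`-coordinates on `ν.restrictScalars ℤ` of vectors of `⊕ ℤνᵢ` are their `ℚ`-coordinates on
`ν` (the integral matrix `M` of «`[R : M_x[R]] = |det M|`»). [cite: Stevenhagen2008NumberRings, §7, p. 231] -/
theorem toMatrix_restrictScalars_map (ν : Basis ι ℚ K) (v : ι → span ℤ (Set.range ν)) :
    ((ν.restrictScalars ℤ).toMatrix v).map (Int.castRingHom ℚ) = ν.toMatrix fun j ↦ (v j : K) := by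
  ext i j
  rw [Matrix.map_apply, Basis.toMatrix_apply, Basis.toMatrix_apply, ← ν.restrictScalars_repr_apply ℤ (v j) i,
    algebraMap_int_eq]

/-- **`[⊕ ℤνᵢ : ⊕ ℤν'ⱼ] = |det_ν(ν')|`**: the index of a full sublattice `⊕ ℤν'ⱼ ⊆ ⊕ ℤνᵢ` of `K` is the absolute
value of the determinant of the (integral) matrix of `ν'` on `ν` («`[R : M_x[R]] = |det M|` for the `ℤ`-module
`R`» in Stevenhagen's words; Mathlib's `Submodule.natAbs_det_basis_change`). [cite: Stevenhagen2008NumberRings, §7,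
p. 231] [cite: Marseglia2024CMType, §2.3 Lemma 2.4 (iv) (proof: «`M = I/J` […] has finite length»), p. 6] -/
theorem natCard_quotient_comap_span_eq_abs_det (ν ν' : Basis ι ℚ K)
    (h : span ℤ (Set.range ν') ≤ span ℤ (Set.range ν)) :
    (Nat.card (↥(span ℤ (Set.range ν)) ⧸ (span ℤ (Set.range ν')).comap (span ℤ (Set.range ν)).subtype) : ℚ) =
      |ν.det ν'| := by
  classical
  let b : Basis ι ℤ (span ℤ (Set.range ν)) := ν.restrictScalars ℤ
  haveI := Module.Free.of_basis b
  haveI := Module.Finite.of_basis b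
  let e : ↥(span ℤ (Set.range ν')) ≃ₗ[ℤ] ↥((span ℤ (Set.range ν')).comap (span ℤ (Set.range ν)).subtype) :=
    (Submodule.comapSubtypeEquivOfLe h).symm
  let bN : Basis ι ℤ ↥((span ℤ (Set.range ν')).comap (span ℤ (Set.range ν)).subtype) :=
    (ν'.restrictScalars ℤ).map e
  have hv : (fun j ↦ (((bN j : (span ℤ (Set.range ν')).comap (span ℤ (Set.range ν)).subtype) :
      span ℤ (Set.range ν)) : K)) = ν' := by
    ext j
    simp [bN, e, Basis.map_apply, Submodule.comapSubtypeEquivOfLe_symm_apply, Basis.restrictScalars_apply]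
  have hdet : ((b.det fun j ↦ ((bN j : (span ℤ (Set.range ν')).comap (span ℤ (Set.range ν)).subtype) :
      span ℤ (Set.range ν))) : ℚ) = ν.det ν' := by
    rw [Basis.det_apply, Basis.det_apply, ← eq_intCast (Int.castRingHom ℚ), RingHom.map_det,
      RingHom.mapMatrix_apply, toMatrix_restrictScalars_map, hv]
  rw [← Submodule.natAbs_det_basis_change b _ bN, Nat.cast_natAbs, Int.cast_abs]
  exact congr_arg _ hdet

/-! ## §2 Dual bases transform by the transpose -/

/-- **The matrix of `νᵗ` on the dual basis `ν'ᵗ` is the transpose of the matrix of `ν'` on `ν`**: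
`(νᵗᵢ)_k = Tr(νᵗᵢ ν'ₖ) = Σ_l (ν'ₖ)_l Tr(νᵗᵢ ν_l) = (ν'ₖ)ᵢ`. [cite: Marseglia2024CMType, §2.3 (the trace dual
`I^t`), p. 5] -/
theorem traceDual_toMatrix_traceDual (ν ν' : Basis ι ℚ K) :
    ν'.traceDual.toMatrix ν.traceDual = (ν.toMatrix ν').transpose := by
  ext k i
  rw [Basis.toMatrix_apply, Matrix.transpose_apply, Basis.toMatrix_apply, Basis.traceDual_repr_apply,
    Algebra.traceForm_apply]
  conv_lhs => rw [← ν.sum_repr (ν' k)]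
  simp only [Finset.mul_sum, mul_smul_comm, map_sum, map_smul, Basis.trace_traceDual_mul, smul_eq_mul,
    mul_ite, mul_one, mul_zero, Finset.sum_ite_eq', Finset.mem_univ, if_true]

/-- **`det_{ν'ᵗ}(νᵗ) = det_ν(ν')`.** [cite: Marseglia2024CMType, §2.3 Lemma 2.4 (iv), p. 6] -/
theorem traceDual_det_traceDual (ν ν' : Basis ι ℚ K) : ν'.traceDual.det ν.traceDual = ν.det ν' := by
  rw [Basis.det_apply, Basis.det_apply, traceDual_toMatrix_traceDual, Matrix.det_transpose]

/-! ## §3 LEMMA 2.4 (iv): `[I : J] = [Jᵗ : Iᵗ]` -/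

/-- **MARSEGLIA 2024 LEMMA 2.4 (iv) (cardinalities): `#(I/J) = #(Jᵗ/Iᵗ)` for full `ℤ`-lattices `J ⊆ I` of a
number field** — both are `|det_ν(ν')|` (§1, §2 and `Iᵗ = ⊕ ℤνᵗᵢ`, `CMLatticeTraceDual.traceDual_span_eq`).
`TODO(general form)`: the `ℤ`-module isomorphism `I/J ≃ Jᵗ/Iᵗ` (Matlis duality). [cite: Marseglia2024CMType,
§2.3 Lemma 2.4 (iv), p. 6] -/
theorem natCard_quotient_comap_eq_natCard_quotient_traceDual (ν ν' : Basis ι ℚ K) {I J : Submodule ℤ K}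
    (hI : I = span ℤ (Set.range ν)) (hJ : J = span ℤ (Set.range ν')) (h : J ≤ I) :
    Nat.card (I ⧸ J.comap I.subtype) =
      Nat.card (↥(traceDual ℤ ℚ J) ⧸ (traceDual ℤ ℚ I).comap (traceDual ℤ ℚ J).subtype) := by
  classical
  subst hI hJ
  have h' : span ℤ (Set.range ν.traceDual) ≤ span ℤ (Set.range ν'.traceDual) := by
    rw [← traceDual_span_eq, ← traceDual_span_eq]
    exact traceDual_anti h
  rw [natCard_quotient_comap_congr (traceDual_span_eq ν') (traceDual_span_eq ν), ← Nat.cast_inj (R := ℚ),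
    natCard_quotient_comap_span_eq_abs_det ν ν' h, natCard_quotient_comap_span_eq_abs_det _ _ h',
    traceDual_det_traceDual]

/-- **`#(Jᵗ/Iᵗ) = |det_ν(ν')|`** (the index of the duals, explicitly). [cite: Marseglia2024CMType, §2.3 Lemma 2.4
(iv), p. 6] -/
theorem abs_det_eq_natCard_quotient_traceDual (ν ν' : Basis ι ℚ K) {I J : Submodule ℤ K}
    (hI : I = span ℤ (Set.range ν)) (hJ : J = span ℤ (Set.range ν')) (h : J ≤ I) :
    |ν.det ν'| = (Nat.card (↥(traceDual ℤ ℚ J) ⧸ (traceDual ℤ ℚ I).comap (traceDual ℤ ℚ J).subtype) : ℚ) := by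
  rw [← natCard_quotient_comap_eq_natCard_quotient_traceDual ν ν' hI hJ h]
  subst hI hJ
  exact (natCard_quotient_comap_span_eq_abs_det ν ν' h).symm

/-- The existential form: for full lattices `J ⊆ I` (each the `ℤ`-span of some `ℚ`-basis indexed by `ι`),
`#(I/J) = #(Jᵗ/Iᵗ)`. [cite: Marseglia2024CMType, §2.3 Lemma 2.4 (iv), p. 6] -/
theorem natCard_quotient_comap_eq_natCard_quotient_traceDual' {I J : Submodule ℤ K}
    (hI : ∃ ν : Basis ι ℚ K, I = span ℤ (Set.range ν)) (hJ : ∃ ν' : Basis ι ℚ K, J = span ℤ (Set.range ν'))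
    (h : J ≤ I) :
    Nat.card (I ⧸ J.comap I.subtype) =
      Nat.card (↥(traceDual ℤ ℚ J) ⧸ (traceDual ℤ ℚ I).comap (traceDual ℤ ℚ J).subtype) := by
  obtain ⟨ν, hν⟩ := hI
  obtain ⟨ν', hν'⟩ := hJ
  exact natCard_quotient_comap_eq_natCard_quotient_traceDual ν ν' hν hν' h

/-! ## §4 Fractional ideals of the order `𝔯 = endOrder (M_μ)`: `#(I/J) = #(Jᵗ/Iᵗ)` -/

section Order

variable (μ : Basis ι ℚ K)

/-- Plumbing: the index of `𝔯`-submodules `J ⊆ I` of `K` is the index of the underlying `ℤ`-lattices («the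
`Z`-modules `I/J` and `J^t/I^t`»). [cite: Marseglia2024CMType, §2.3 Lemma 2.4 (iv), p. 6] -/
theorem natCard_quotient_comap_restrictScalars (I J : Submodule (endOrder (Algebra.leftMulMatrix μ)) K) :
    Nat.card (↥(I.restrictScalars ℤ) ⧸ (J.restrictScalars ℤ).comap (I.restrictScalars ℤ).subtype) =
      Nat.card (I ⧸ J.comap I.subtype) :=
  rfl

/-- **LEMMA 2.4 (iv) for the fractional ideals of an order: `#(I/J) = #(Jᵗ/Iᵗ)`** — for nonzero fractional
`𝔯`-ideals `J ⊆ I` of `𝔯 = endOrder (M_μ)` (a number field of any degree) and their trace duals `T_I = Iᵗ`,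
`T_J = Jᵗ` (`CMOrderGorenstein.exists_coe_eq_traceDual`), the indices `[I : J]` and `[Jᵗ : Iᵗ]` agree.
[cite: Marseglia2024CMType, §2.3 Lemma 2.4 (iv), p. 6] -/
theorem natCard_quotient_coe_eq_natCard_quotient_traceDual
    {I J T₁ T₂ : FractionalIdeal (endOrder (Algebra.leftMulMatrix μ))⁰ K} (hI : I ≠ 0) (hJ : J ≠ 0)
    (h : J ≤ I)
    (hT₁ : (T₁ : Submodule (endOrder (Algebra.leftMulMatrix μ)) K) =
      traceDual ℤ ℚ (I : Submodule (endOrder (Algebra.leftMulMatrix μ)) K))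
    (hT₂ : (T₂ : Submodule (endOrder (Algebra.leftMulMatrix μ)) K) =
      traceDual ℤ ℚ (J : Submodule (endOrder (Algebra.leftMulMatrix μ)) K)) :
    Nat.card (↥(I : Submodule (endOrder (Algebra.leftMulMatrix μ)) K) ⧸
        (J : Submodule (endOrder (Algebra.leftMulMatrix μ)) K).comap
          (I : Submodule (endOrder (Algebra.leftMulMatrix μ)) K).subtype) =
      Nat.card (↥(T₂ : Submodule (endOrder (Algebra.leftMulMatrix μ)) K) ⧸
        (T₁ : Submodule (endOrder (Algebra.leftMulMatrix μ)) K).comap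
          (T₂ : Submodule (endOrder (Algebra.leftMulMatrix μ)) K).subtype) := by
  classical
  obtain ⟨ν, hν⟩ := exists_basis_span_eq_restrictScalars_coe μ hI
  obtain ⟨ν', hν'⟩ := exists_basis_span_eq_restrictScalars_coe μ hJ
  have h' : (J : Submodule (endOrder (Algebra.leftMulMatrix μ)) K).restrictScalars ℤ ≤
      (I : Submodule (endOrder (Algebra.leftMulMatrix μ)) K).restrictScalars ℤ := fun x hx ↦ coe_le_coe.2 h hx
  rw [← natCard_quotient_comap_restrictScalars μ, ← natCard_quotient_comap_restrictScalars μ,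
    natCard_quotient_comap_eq_natCard_quotient_traceDual ν ν' hν.symm hν'.symm h']
  exact natCard_quotient_comap_congr (by rw [hT₂, restrictScalars_traceDual_eq])
    (by rw [hT₁, restrictScalars_traceDual_eq])

end Order

/-! ## §5 MARSEGLIA 2024 PROPOSITION 3.5: `#((𝔭:𝔭)/𝔭) = #(𝔯/𝔭)^(type_𝔭(𝔯) + 1)` at a non-invertible prime -/

section TypeFormula

variable (μ : Basis ι ℚ K) [Nonempty ι] [IsFractionRing (endOrder (Algebra.leftMulMatrix μ)) K]

omit [NumberField K] [Fintype ι] [DecidableEq ι] in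
/-- Plumbing: `#(I/J)` is Mathlib's relative index `[I : J ∩ I]` of the additive groups (the tower
`𝔭 ⊆ S ⊆ (𝔭:𝔭)` of «`(𝔭:𝔭)/S ⊕ S/𝔭`» is counted with `AddSubgroup.relIndex_mul_relIndex`).
[cite: Marseglia2024CMType, §3 Prop. 3.5 (proof), p. 9] -/
theorem natCard_quotient_comap_eq_relIndex {R : Type*} [Ring R] [Module R K] (I J : Submodule R K) :
    Nat.card (I ⧸ J.comap I.subtype) = J.toAddSubgroup.relIndex I.toAddSubgroup :=
  rfl

omit [Nonempty ι] in
/-- Plumbing: `#(𝔯/𝔭)` computed inside `K` — the index of `↑𝔭` in `↑1 = 𝔯·1 ⊆ K` is `#(𝔯 ⧸ 𝔭)` (the summand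
«`S/𝔭`»). [cite: Marseglia2024CMType, §3 Prop. 3.5 (proof), p. 9] -/
theorem natCard_quotient_coe_one_comap_coeIdeal (𝔭 : Ideal (endOrder (Algebra.leftMulMatrix μ))) :
    Nat.card (↥((1 : FractionalIdeal (endOrder (Algebra.leftMulMatrix μ))⁰ K) :
        Submodule (endOrder (Algebra.leftMulMatrix μ)) K) ⧸
      ((𝔭 : FractionalIdeal (endOrder (Algebra.leftMulMatrix μ))⁰ K) :
          Submodule (endOrder (Algebra.leftMulMatrix μ)) K).comap
        ((1 : FractionalIdeal (endOrder (Algebra.leftMulMatrix μ))⁰ K) :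
          Submodule (endOrder (Algebra.leftMulMatrix μ)) K).subtype) =
      Nat.card (endOrder (Algebra.leftMulMatrix μ) ⧸ 𝔭) := by
  have hinj : Function.Injective (Algebra.linearMap (endOrder (Algebra.leftMulMatrix μ)) K) :=
    IsFractionRing.injective _ K
  have h1 : LinearMap.range (Algebra.linearMap (endOrder (Algebra.leftMulMatrix μ)) K) =
      ((1 : FractionalIdeal (endOrder (Algebra.leftMulMatrix μ))⁰ K) :
        Submodule (endOrder (Algebra.leftMulMatrix μ)) K) := by
    rw [coe_one, Submodule.one_eq_range]
  let e : endOrder (Algebra.leftMulMatrix μ) ≃ₗ[endOrder (Algebra.leftMulMatrix μ)]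
      ↥((1 : FractionalIdeal (endOrder (Algebra.leftMulMatrix μ))⁰ K) :
        Submodule (endOrder (Algebra.leftMulMatrix μ)) K) :=
    (LinearEquiv.ofInjective _ hinj).trans (LinearEquiv.ofEq _ _ h1)
  have he : ∀ r, ((e r : ↥((1 : FractionalIdeal (endOrder (Algebra.leftMulMatrix μ))⁰ K) :
      Submodule (endOrder (Algebra.leftMulMatrix μ)) K)) : K) = algebraMap _ K r := fun r ↦ rfl
  refine (Nat.card_congr (Submodule.Quotient.equiv (Submodule.restrictScalars _ 𝔭) _ e ?_).toEquiv).symm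
  ext ⟨x, hx⟩
  simp only [Submodule.mem_map, Submodule.restrictScalars_mem, LinearEquiv.coe_coe, Submodule.mem_comap,
    Submodule.subtype_apply, mem_coe, mem_coeIdeal]
  constructor
  · rintro ⟨r, hr, hrx⟩
    exact ⟨r, hr, by rw [← he r, hrx]⟩
  · rintro ⟨r, hr, hrx⟩
    exact ⟨r, hr, Subtype.ext (by rw [he r, hrx])⟩

omit [Nonempty ι] [IsFractionRing (endOrder (Algebra.leftMulMatrix μ)) K] in
/-- Plumbing: `#(I/𝔭I)` computed inside `K` is the cardinality of the `𝔯/𝔭`-space `I/𝔭I = ↥I ⧸ 𝔭 • ⊤` (the term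
«`dim_{S/𝔭} S^t/𝔭S^t`»). [cite: Marseglia2024CMType, §3 Prop. 3.5 (proof), p. 9] -/
theorem natCard_quotient_comap_coeIdeal_mul (𝔭 : Ideal (endOrder (Algebra.leftMulMatrix μ)))
    (I : FractionalIdeal (endOrder (Algebra.leftMulMatrix μ))⁰ K) :
    Nat.card (↥(I : Submodule (endOrder (Algebra.leftMulMatrix μ)) K) ⧸
      (((𝔭 : FractionalIdeal (endOrder (Algebra.leftMulMatrix μ))⁰ K) * I :
          FractionalIdeal (endOrder (Algebra.leftMulMatrix μ))⁰ K) :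
            Submodule (endOrder (Algebra.leftMulMatrix μ)) K).comap
        (I : Submodule (endOrder (Algebra.leftMulMatrix μ)) K).subtype) =
      Nat.card (↥(I : Submodule (endOrder (Algebra.leftMulMatrix μ)) K) ⧸
        (𝔭 • ⊤ : Submodule (endOrder (Algebra.leftMulMatrix μ))
          (I : Submodule (endOrder (Algebra.leftMulMatrix μ)) K))) := by
  have : (((𝔭 : FractionalIdeal (endOrder (Algebra.leftMulMatrix μ))⁰ K) * I :
      FractionalIdeal (endOrder (Algebra.leftMulMatrix μ))⁰ K) :
        Submodule (endOrder (Algebra.leftMulMatrix μ)) K).comap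
      (I : Submodule (endOrder (Algebra.leftMulMatrix μ)) K).subtype = 𝔭 • ⊤ := by
    ext x
    rw [Submodule.mem_comap, Submodule.subtype_apply, NumberRing.coe_coeIdeal_mul, NumberRing.mem_smul_top_iff]
  rw [this]

/-- **`#((𝔭:𝔭)/𝔯) = #(𝔯ᵗ/𝔭𝔯ᵗ)` at a non-invertible prime** («`(𝔭S^t)^t = (S:𝔭) = (𝔭:𝔭)`. Therefore, the quotient
`(𝔭S^t)^t/S = (𝔭:𝔭)/S` is isomorphic (as a `Z`-module) to `S^t/𝔭S^t` by Lemma 2.4.(iv)» — here: equal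
cardinalities, by §4 with `I = 𝔯ᵗ ⊇ J = 𝔭𝔯ᵗ`, `𝔯ᵗᵗ = 𝔯`, `(𝔭𝔯ᵗ)ᵗ = (𝔯:𝔭)` (`CMOrderGorenstein.coe_div_eq_traceDual_mul`)
and `(𝔭:𝔭) = (𝔯:𝔭)` (`CMOrderMultiplicatorRingExtension.coeIdeal_div_self_eq_one_div_of_not_isUnit`)).
[cite: Marseglia2024CMType, §3 Prop. 3.5 (proof), p. 9] -/
theorem natCard_quotient_div_self_comap_one_eq {T : FractionalIdeal (endOrder (Algebra.leftMulMatrix μ))⁰ K}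
    (hT : (T : Submodule (endOrder (Algebra.leftMulMatrix μ)) K) =
      traceDual ℤ ℚ ((1 : FractionalIdeal (endOrder (Algebra.leftMulMatrix μ))⁰ K) :
        Submodule (endOrder (Algebra.leftMulMatrix μ)) K))
    (𝔭 : Ideal (endOrder (Algebra.leftMulMatrix μ))) [h𝔭 : 𝔭.IsMaximal]
    (h : ¬ IsUnit (𝔭 : FractionalIdeal (endOrder (Algebra.leftMulMatrix μ))⁰ K)) :
    Nat.card (↥(((𝔭 : FractionalIdeal (endOrder (Algebra.leftMulMatrix μ))⁰ K) / 𝔭 :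
        FractionalIdeal (endOrder (Algebra.leftMulMatrix μ))⁰ K) : Submodule (endOrder (Algebra.leftMulMatrix μ)) K) ⧸
      ((1 : FractionalIdeal (endOrder (Algebra.leftMulMatrix μ))⁰ K) :
          Submodule (endOrder (Algebra.leftMulMatrix μ)) K).comap
        (((𝔭 : FractionalIdeal (endOrder (Algebra.leftMulMatrix μ))⁰ K) / 𝔭 :
          FractionalIdeal (endOrder (Algebra.leftMulMatrix μ))⁰ K) :
            Submodule (endOrder (Algebra.leftMulMatrix μ)) K).subtype) =
      Nat.card (↥(T : Submodule (endOrder (Algebra.leftMulMatrix μ)) K) ⧸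
        (𝔭 • ⊤ : Submodule (endOrder (Algebra.leftMulMatrix μ))
          (T : Submodule (endOrder (Algebra.leftMulMatrix μ)) K))) := by
  have h0 : 𝔭 ≠ ⊥ := Ring.ne_bot_of_isMaximal_of_not_isField h𝔭 EndOrder.not_isField
  have hP0 : (𝔭 : FractionalIdeal (endOrder (Algebra.leftMulMatrix μ))⁰ K) ≠ 0 := coeIdeal_ne_zero.2 h0
  have h10 : (1 : FractionalIdeal (endOrder (Algebra.leftMulMatrix μ))⁰ K) ≠ 0 := one_ne_zero
  have hT0 : T ≠ 0 := ne_zero_of_coe_eq_traceDual_one μ hT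
  -- `(𝔭:𝔭) = (𝔯:𝔭) = (𝔭𝔯ᵗ)ᵗ` and `𝔯 = 𝔯ᵗᵗ`
  have hM : (((𝔭 : FractionalIdeal (endOrder (Algebra.leftMulMatrix μ))⁰ K) / 𝔭 :
      FractionalIdeal (endOrder (Algebra.leftMulMatrix μ))⁰ K) : Submodule (endOrder (Algebra.leftMulMatrix μ)) K) =
      traceDual ℤ ℚ (((𝔭 : FractionalIdeal (endOrder (Algebra.leftMulMatrix μ))⁰ K) * T :
        FractionalIdeal (endOrder (Algebra.leftMulMatrix μ))⁰ K) : Submodule (endOrder (Algebra.leftMulMatrix μ)) K) := by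
    rw [EndOrder.coeIdeal_div_self_eq_one_div_of_not_isUnit 𝔭 h, coe_div_eq_traceDual_mul μ h10 hP0 hT, mul_comm]
  have hO : ((1 : FractionalIdeal (endOrder (Algebra.leftMulMatrix μ))⁰ K) :
      Submodule (endOrder (Algebra.leftMulMatrix μ)) K) =
      traceDual ℤ ℚ (T : Submodule (endOrder (Algebra.leftMulMatrix μ)) K) := by
    rw [hT, traceDual_traceDual_coe μ h10]
  have hle : (𝔭 : FractionalIdeal (endOrder (Algebra.leftMulMatrix μ))⁰ K) * T ≤ T := by
    rw [← coe_le_coe, NumberRing.coe_coeIdeal_mul]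
    exact Submodule.smul_le_right
  have hPT0 : (𝔭 : FractionalIdeal (endOrder (Algebra.leftMulMatrix μ))⁰ K) * T ≠ 0 := by
    obtain ⟨p, hp, hp0⟩ := Submodule.exists_mem_ne_zero_of_ne_bot h0
    obtain ⟨t, ht0, ht⟩ := exists_ne_zero_mem_isInteger hT0
    have hmem : algebraMap _ K p * algebraMap _ K t ∈
        (𝔭 : FractionalIdeal (endOrder (Algebra.leftMulMatrix μ))⁰ K) * T :=
      mul_mem_mul ((mem_coeIdeal _).2 ⟨p, hp, rfl⟩) ht
    intro hz
    rw [hz, mem_zero_iff] at hmem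
    exact mul_ne_zero (mt (IsFractionRing.to_map_eq_zero_iff (K := K)).1 hp0)
      (mt (IsFractionRing.to_map_eq_zero_iff (K := K)).1 ht0) hmem
  rw [← natCard_quotient_coe_eq_natCard_quotient_traceDual μ hT0 hPT0 hle hO hM,
    natCard_quotient_comap_coeIdeal_mul]

/-- **MARSEGLIA 2024 PROPOSITION 3.5 («Let `𝔭` be a non-invertible prime of `S`. Then
`type_𝔭(S) + 1 = dim_{S/𝔭} (𝔭:𝔭)/𝔭`»), read on cardinalities: `#((𝔭:𝔭)/𝔭) = #(𝔯/𝔭)^(type_𝔭(𝔯) + 1)`** where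
`type_𝔭(𝔯) = dim_{𝔯/𝔭} 𝔯ᵗ/𝔭𝔯ᵗ` (`CMOrderCohenMacaulayTypeOne`), for the order `𝔯 = endOrder (M_μ)` of a number field
of any degree: `#((𝔭:𝔭)/𝔭) = #((𝔭:𝔭)/𝔯)·#(𝔯/𝔭)` and `#((𝔭:𝔭)/𝔯) = #(𝔯ᵗ/𝔭𝔯ᵗ) = #(𝔯/𝔭)^{type_𝔭(𝔯)}`.
[cite: Marseglia2024CMType, §3 Prop. 3.5, p. 9] -/
theorem natCard_quotient_div_self_comap_coeIdeal_eq_pow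
    {T : FractionalIdeal (endOrder (Algebra.leftMulMatrix μ))⁰ K}
    (hT : (T : Submodule (endOrder (Algebra.leftMulMatrix μ)) K) =
      traceDual ℤ ℚ ((1 : FractionalIdeal (endOrder (Algebra.leftMulMatrix μ))⁰ K) :
        Submodule (endOrder (Algebra.leftMulMatrix μ)) K))
    (𝔭 : Ideal (endOrder (Algebra.leftMulMatrix μ))) [h𝔭 : 𝔭.IsMaximal]
    (h : ¬ IsUnit (𝔭 : FractionalIdeal (endOrder (Algebra.leftMulMatrix μ))⁰ K)) :
    Nat.card (↥(((𝔭 : FractionalIdeal (endOrder (Algebra.leftMulMatrix μ))⁰ K) / 𝔭 :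
        FractionalIdeal (endOrder (Algebra.leftMulMatrix μ))⁰ K) : Submodule (endOrder (Algebra.leftMulMatrix μ)) K) ⧸
      ((𝔭 : FractionalIdeal (endOrder (Algebra.leftMulMatrix μ))⁰ K) :
          Submodule (endOrder (Algebra.leftMulMatrix μ)) K).comap
        (((𝔭 : FractionalIdeal (endOrder (Algebra.leftMulMatrix μ))⁰ K) / 𝔭 :
          FractionalIdeal (endOrder (Algebra.leftMulMatrix μ))⁰ K) :
            Submodule (endOrder (Algebra.leftMulMatrix μ)) K).subtype) =
      Nat.card (endOrder (Algebra.leftMulMatrix μ) ⧸ 𝔭) ^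
        (Module.finrank (endOrder (Algebra.leftMulMatrix μ) ⧸ 𝔭)
          (↥(T : Submodule (endOrder (Algebra.leftMulMatrix μ)) K) ⧸
            (𝔭 • ⊤ : Submodule (endOrder (Algebra.leftMulMatrix μ))
              (T : Submodule (endOrder (Algebra.leftMulMatrix μ)) K))) + 1) := by
  have h0 : 𝔭 ≠ ⊥ := Ring.ne_bot_of_isMaximal_of_not_isField h𝔭 EndOrder.not_isField
  have hP0 : (𝔭 : FractionalIdeal (endOrder (Algebra.leftMulMatrix μ))⁰ K) ≠ 0 := coeIdeal_ne_zero.2 h0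
  -- the tower `𝔭 ⊆ 𝔯 ⊆ (𝔭:𝔭)` inside `K`
  have hPO : (𝔭 : FractionalIdeal (endOrder (Algebra.leftMulMatrix μ))⁰ K) ≤ 1 := coeIdeal_le_one
  have hOM : (1 : FractionalIdeal (endOrder (Algebra.leftMulMatrix μ))⁰ K) ≤
      (𝔭 : FractionalIdeal (endOrder (Algebra.leftMulMatrix μ))⁰ K) / 𝔭 :=
    (le_div_iff_mul_le hP0).2 (by rw [one_mul])
  -- `#((𝔭:𝔭)/𝔭) = #(𝔯/𝔭) · #((𝔭:𝔭)/𝔯)`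
  rw [natCard_quotient_comap_eq_relIndex, ← AddSubgroup.relIndex_mul_relIndex _ _ _
      ((Submodule.toAddSubgroup_le _ _).2 (coe_le_coe.2 hPO)) ((Submodule.toAddSubgroup_le _ _).2 (coe_le_coe.2 hOM)),
    ← natCard_quotient_comap_eq_relIndex, ← natCard_quotient_comap_eq_relIndex,
    natCard_quotient_coe_one_comap_coeIdeal, natCard_quotient_div_self_comap_one_eq μ hT 𝔭 h, pow_succ, mul_comm]
  -- `#(𝔯ᵗ/𝔭𝔯ᵗ) = #(𝔯/𝔭)^{type}`
  congr 1
  letI : Field (endOrder (Algebra.leftMulMatrix μ) ⧸ 𝔭) := Ideal.Quotient.field 𝔭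
  haveI := CMTypeLattice.isNoetherianRing_endOrder (Algebra.leftMulMatrix μ)
  haveI := NumberRing.finite_quotient_smul_top (K := K) 𝔭
    (fg_of_isNoetherianRing le_rfl T : (T : Submodule (endOrder (Algebra.leftMulMatrix μ)) K).FG)
  exact Module.natCard_eq_pow_finrank

end TypeFormula

end CMTypeLattice

end Literature.NumberTheory.ComplexMultiplication
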